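import Literature.Geometry.Kaehler.ComplexTorusInverseLefschetzKleiman
import HarnessLib

/-!
# Kleiman's iterated dual Lefschetz operator against the powers of `L`, in every exponent:
# `Λʲ ∘ L^{i+j} = Lⁱ` below the middle degree and `Λʲ = Lⁱ ∘ Λ^{i+j}` above it

Layer `Literature/Geometry/Kaehler`, namespace `Literature.Geometry.Kaehler.ComplexTorus`; lane `lit-hodgefound` (Track 2 foundations
library, Layer A4), prover seat `lit-hodgefound-p35` (gen 43, row g43-#1). A sequel, BY NAME, of p08's `ComplexTorusKleimanLefschetzOperators`
(Q633: Kleiman's `Λ = kleimanDual η m : H^{m+2}(X, ℂ) → Hᵐ(X, ℂ)` on the invariant forms `Hᵐ(X, ℂ) = Alt^m_ℝ(E; ℂ)` of a complex torus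
`X = E/Λ` with a non-degenerate real `2`-form `η`, "each `Λ` peels off one `L`", the Lefschetz-decomposition induction
`lefschetzSummand_induction`, hard Lefschetz `lefschetzPow_bijective_of_add_eq`) and `ComplexTorusInverseLefschetzKleiman` (g7-#3: the iterate
`Λᵗ = kleimanDualPow η m t : H^{m+2t} → Hᵐ`, `kleimanDualPow_lefschetzPow_add_of_mem_primitiveForms`, `Λᵗ ∘ Lᵗ = id` for `m + t ≤ g`).

Milne (proof of Thm. 5.9): "`Λ`, regarded as a map of cohomology groups, is inverse to `L`". The tree has this for ONE power against ONE
power (`kleimanDual_comp_lefschetzPow_one`: `Λ ∘ L = id` below the middle; `kleimanDualPow_comp_lefschetzPow`: `Λᵗ ∘ Lᵗ = id`; p08's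
`kleimanDual_eq_lefschetzPow_comp_kleimanDualPow`: `Λ = Lᵛ ∘ Λ^{v+1}` on `H^{g+v+1}`). THIS FILE records the general bookkeeping of
exponents, with explicit target degrees (one `finCongr` reindexing where the degree arithmetic is not definitional), as needed to move
Kleiman's operators across the middle degree on the Hodge lattice (the seat's `…LefschetzDecompositionKleimanDualAboveMiddle`):

* §1 **`kleimanDualPow_lefschetzPow_eq_lefschetzPow`** — BELOW THE MIDDLE: `Λʲ(L^{i+j} y) = Lⁱ y` for every `y ∈ Hⁿ(X, ℂ)` with
  `n + i + j ≤ g` (on `Lʳα`, `α` primitive, `Λʲ` peels `j` of the `i + j + r` copies of `L`; Milne's range condition holds because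
  `n + i + j ≤ g`), and the operator form **`kleimanDualPow_comp_lefschetzPow_eq_lefschetzPow`**;
* §2 **`kleimanDualPow_domDomCongr_eq_lefschetzPow_kleimanDualPow`** — ABOVE THE MIDDLE: on `H^{n+2t}(X, ℂ)` with `n + t = g` and
  `t = i + j`, `Λʲ = Lⁱ ∘ Λᵗ` (`Λᵗ : H^{g+t} ⥲ H^{g−t}` the inverse of the hard Lefschetz isomorphism `Lᵗ`; write `x = Lᵗy` and use §1):
  every iterate `Λʲ`, `j ≤ t`, starting above the middle degree FACTORS THROUGH THE INVERSE LEFSCHETZ ISOMORPHISM followed by a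
  power of `L` — the form in which "`Λ` is inverse to `L`" is used on integral classes (an algebraic inverse of `Lᵗ` with a known
  denominator gives one for every `Λʲ`). p08's `kleimanDual_eq_lefschetzPow_comp_kleimanDualPow` is the case `j = 1`.

Theorems only; NO definition, NO named fact, no `sorry` (D-0026); no `instance`, no notation.

## The sources, as printed

J. S. Milne, *Lefschetz classes on abelian varieties*, Duke Math. J. 96 (1999) 639–675, held `paper:doi-10-1215-s0012-7094-99-09620-5`, p. 664
(p0026 L42–L50): "Any `x ∈ Hˢ(X)` can be written unquely in the form `x = Σ_{i ≥ 0, s−d} Lⁱxᵢ` with `xᵢ` a primitive element of `H^{s−2i}(X)`.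
For `x = Σ Lⁱxᵢ ∈ Hˢ(X)`, define `Λx = Σ_{i ≥ s−d, 1} L^{i−1}xᵢ`"; p. 665 (p0027 L5–L6): "*Proof.* It is known (e.g., Kleiman 1968, p367) that
`Λ`, regarded as a map of cohomology groups, is inverse to `L`."; Rem. 5.11 (p0027 L54–L62): "`((−1)ⁱ/√deg(λ_D)) f_i` is the inverse of the
strong Lefschetz isomorphism “cup with `[D]^{g−i}`”". S. Kleiman, *Algebraic cycles and the Weil conjectures* (1968), §1.4 (through Milne; not
held, acq-14408).

## References
* [Milne1999LefschetzClasses] J. S. Milne, Lefschetz classes on abelian varieties, Duke Math. J. 96 (1999) — §5 p. 664 (p0026 L42–L50), proof of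
  Thm. 5.9 (p0027 L5–L6), Rem. 5.11 (p0027 L54–L62).
* [Kleiman1968AlgebraicCycles] S. L. Kleiman, Algebraic cycles and the Weil conjectures, in: Dix exposés sur la cohomologie des schémas (1968) — §1.4,
  p. 367 (through Milne).
* [Lange2023AbelianVarietiesComplex] H. Lange, Abelian Varieties over the Complex Numbers, Springer 2023 — §7.3.2 (1), (3) (p0338 L3–L16).
-/

noncomputable section

open Module Finset

namespace Literature.Geometry.Kaehler

namespace ComplexTorus

section Exponents

variable {E : Type*} [NormedAddCommGroup E] [NormedSpace ℂ E] [FiniteDimensional ℂ E]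

omit [FiniteDimensional ℂ E] in
/-- `Lʳ` with propositionally equal exponents. [folklore] -/
private theorem lefschetzPow_congr₄₅ (η : E [⋀^Fin 2]→L[ℝ] ℝ) {r r' : ℕ} (hr : r = r') {m k : ℕ} (h : 2 * r + m = k) (h' : 2 * r' + m = k)
    (ψ : E [⋀^Fin m]→L[ℝ] ℂ) : lefschetzPow η r h ψ = lefschetzPow η r' h' ψ := by
  subst hr
  rfl

omit [FiniteDimensional ℂ E] in
/-- Reindexing the target of `Lʳ` is changing its target-degree certificate. [folklore] -/
private theorem lefschetzPow_domDomCongr₄₅ (η : E [⋀^Fin 2]→L[ℝ] ℝ) (r : ℕ) {m k k' : ℕ} (h : 2 * r + m = k) (hk : k = k') (ψ : E [⋀^Fin m]→L[ℝ] ℂ) :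
    (lefschetzPow η r h ψ).domDomCongr (finCongr hk) = lefschetzPow η r (h.trans hk) ψ := by
  subst hk
  rfl

variable {η : E [⋀^Fin 2]→L[ℝ] ℝ} (hη : ∀ v : E, v ≠ 0 → ∃ w : E, η ![v, w] ≠ 0)

include hη

/-! ## §1 Below the middle degree: `Λʲ ∘ L^{i+j} = Lⁱ` on `Hⁿ(X, ℂ)`, `n + i + j ≤ g` -/

/-- **`Λʲ(L^{i+j} y) = Lⁱ y` FOR EVERY `y ∈ Hⁿ(X, ℂ)`, `n + i + j ≤ g`** — "`Λ`, regarded as a map of cohomology groups, is inverse to `L`" with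
exponents: on a Lefschetz summand `y = Lʳα`, `α ∈ P^{n−2r}` primitive, `L^{i+j}y = L^{i+j+r}α` lies in Milne's range of `H^{n+2i+2j}` (because
`n + i + j ≤ g`) and `Λʲ` peels off `j` copies of `L` (p08's `kleimanDualPow_lefschetzPow_add_of_mem_primitiveForms`). Degrees: `Lⁱ : Hⁿ → Hᵐ`
(`2i + n = m`), `L^{i+j} : Hⁿ → H^{m+2j}`, `Λʲ : H^{m+2j} → Hᵐ`, `t = i + j`. [cite: Milne1999LefschetzClasses, §5 p. 664 (p0026 L42–L50) and proof of Thm. 5.9 (p0027 L5–L6)]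
[cite: Kleiman1968AlgebraicCycles, §1.4 p. 367] -/
theorem kleimanDualPow_lefschetzPow_eq_lefschetzPow {n m t i j : ℕ} (hnt : n + t ≤ finrank ℂ E) (ht : i + j = t) (hM : 2 * t + n = m + 2 * j)
    (hm : 2 * i + n = m) (y : E [⋀^Fin n]→L[ℝ] ℂ) :
    kleimanDualPow η m j (lefschetzPow η t hM y) = lefschetzPow η i hm y := by
  refine lefschetzSummand_induction hη (m := n) (by omega) (C := fun y ↦ kleimanDualPow η m j (lefschetzPow η t hM y) = lefschetzPow η i hm y)
    (fun r k hk hr α hα ↦ ?_) (by rw [map_zero, map_zero, map_zero]) (fun x x' hx hx' ↦ by rw [map_add, map_add, map_add, hx, hx']) y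
  rw [lefschetzPow_lefschetzPow, lefschetzPow_lefschetzPow,
    lefschetzPow_congr₄₅ η (show t + r = (i + r) + j by omega) _ (show 2 * ((i + r) + j) + k = m + 2 * j by omega)]
  exact kleimanDualPow_lefschetzPow_add_of_mem_primitiveForms hη (show 2 * (i + r) + k = m by omega) hα j (by omega) _

/-- **`Λʲ ∘ L^{i+j} = Lⁱ` as operators `Hⁿ(X, ℂ) → Hᵐ(X, ℂ)`, `n + i + j ≤ g`** (p08's `kleimanDualPow_comp_lefschetzPow` is `i = 0`, `kleimanDual_comp_lefschetzPow_one`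
is `i = 0`, `j = 1`). [cite: Milne1999LefschetzClasses, §5 proof of Thm. 5.9 (p0027 L5–L6)] [cite: Kleiman1968AlgebraicCycles, §1.4 p. 367] -/
theorem kleimanDualPow_comp_lefschetzPow_eq_lefschetzPow {n m t i j : ℕ} (hnt : n + t ≤ finrank ℂ E) (ht : i + j = t) (hM : 2 * t + n = m + 2 * j)
    (hm : 2 * i + n = m) : kleimanDualPow η m j ∘ₗ lefschetzPow η t hM = lefschetzPow η i hm :=
  LinearMap.ext fun y ↦ kleimanDualPow_lefschetzPow_eq_lefschetzPow hη hnt ht hM hm y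

/-! ## §2 Above the middle degree: `Λʲ = Lⁱ ∘ Λ^{i+j}` on `H^{g+t}(X, ℂ)`, `t = i + j` -/

/-- **`Λʲ = Lⁱ ∘ Λᵗ` ON `H^{n+2t}(X, ℂ) = H^{g+t}(X, ℂ)`, `n + t = g`, `t = i + j`: ABOVE THE MIDDLE DEGREE EVERY ITERATE `Λʲ`, `j ≤ t`, FACTORS THROUGH THE INVERSE
`Λᵗ : H^{g+t} ⥲ H^{g−t}` OF THE HARD LEFSCHETZ ISOMORPHISM `Lᵗ`** ("`Λ` … is inverse to `L`"; "… is the inverse of the strong Lefschetz isomorphism 'cup with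
`[D]^{g−i}`'"): write `x = Lᵗy` (`Lᵗ` is onto `H^{g+t}`, `lefschetzPow_bijective_of_add_eq`), then `Λʲx = Λʲ L^{i+j} y = Lⁱy` (§1) and `Λᵗx = y`
(`kleimanDualPow_lefschetzPow`). Degrees: `x ∈ H^{n+2t}` is re-read in `H^{m+2j}` (`m = n + 2i`) along `hM`. p08's `kleimanDual_eq_lefschetzPow_comp_kleimanDualPow` is `j = 1`.
[cite: Milne1999LefschetzClasses, §5 proof of Thm. 5.9 (p0027 L5–L6) and Rem. 5.11 (p0027 L54–L62)] [cite: Kleiman1968AlgebraicCycles, §1.4 p. 367]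
[cite: Lange2023AbelianVarietiesComplex, §7.3.2 (1), (3) (p0338 L3–L16)] -/
theorem kleimanDualPow_domDomCongr_eq_lefschetzPow_kleimanDualPow {n m t i j : ℕ} (hnt : n + t = finrank ℂ E) (ht : i + j = t) (hM : n + 2 * t = m + 2 * j)
    (hm : 2 * i + n = m) (x : E [⋀^Fin (n + 2 * t)]→L[ℝ] ℂ) :
    kleimanDualPow η m j (x.domDomCongr (finCongr hM)) = lefschetzPow η i hm (kleimanDualPow η n t x) := by
  obtain ⟨y, rfl⟩ := (lefschetzPow_bijective_of_add_eq hη hnt (show 2 * t + n = n + 2 * t by omega)).2 x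
  rw [kleimanDualPow_lefschetzPow hη hnt.le _ y, lefschetzPow_domDomCongr₄₅, kleimanDualPow_lefschetzPow_eq_lefschetzPow hη hnt.le ht _ hm y]

/-- **`Λʲ(Lᵗ y) = Lⁱ y` read from above the middle**: for `y ∈ Hⁿ(X, ℂ)`, `n + t = g`, `t = i + j`, the iterate `Λʲ` of the image `Lᵗy ∈ H^{g+t}` (re-read in `H^{m+2j}`)
is `Lⁱy` — the operator `Λʲ ∘ Lᵗ = Lⁱ` on `H^{g−t}`. [cite: Milne1999LefschetzClasses, §5 proof of Thm. 5.9 (p0027 L5–L6)] [cite: Kleiman1968AlgebraicCycles, §1.4 p. 367] -/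
theorem kleimanDualPow_domDomCongr_lefschetzPow_eq_lefschetzPow {n m t i j : ℕ} (hnt : n + t = finrank ℂ E) (ht : i + j = t) (hT : 2 * t + n = n + 2 * t)
    (hM : n + 2 * t = m + 2 * j) (hm : 2 * i + n = m) (y : E [⋀^Fin n]→L[ℝ] ℂ) :
    kleimanDualPow η m j ((lefschetzPow η t hT y).domDomCongr (finCongr hM)) = lefschetzPow η i hm y := by
  rw [kleimanDualPow_domDomCongr_eq_lefschetzPow_kleimanDualPow hη hnt ht hM hm, kleimanDualPow_lefschetzPow hη hnt.le hT y]

/-- **Above the middle degree `Λʲ` is injective** (`j ≤ t`, on `H^{g+t}(X, ℂ)`): `Λʲ = Lⁱ ∘ Λᵗ` with `Λᵗ` bijective and `Lⁱ` injective on `H^{g−t}` (`i ≤ t`; hard Lefschetz).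
[cite: Milne1999LefschetzClasses, §5 p. 664 (p0026 L42–L50) and proof of Thm. 5.9 (p0027 L5–L6)] [cite: Lange2023AbelianVarietiesComplex, §7.3.2 (1) (p0338 L3–L5)] -/
theorem kleimanDualPow_domDomCongr_injective {n m t i j : ℕ} (hnt : n + t = finrank ℂ E) (ht : i + j = t) (hM : n + 2 * t = m + 2 * j) (hm : 2 * i + n = m) :
    Function.Injective fun x : E [⋀^Fin (n + 2 * t)]→L[ℝ] ℂ ↦ kleimanDualPow η m j (x.domDomCongr (finCongr hM)) := by
  intro x x' hxx'
  simp only [kleimanDualPow_domDomCongr_eq_lefschetzPow_kleimanDualPow hη hnt ht hM hm] at hxx'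
  -- `Lⁱ` is injective on `H^{g−t}` (`i ≤ t`): `Lᵗ = Lʲ ∘ Lⁱ` is bijective
  have hLi : Function.Injective (lefschetzPow η i hm (m := n)) := by
    refine Function.Injective.of_comp (f := lefschetzPow η j (show 2 * j + m = n + 2 * t by omega)) ?_
    have hcomp : (lefschetzPow η j (show 2 * j + m = n + 2 * t by omega) ∘ lefschetzPow η i hm (m := n)) =
        lefschetzPow η t (show 2 * t + n = n + 2 * t by omega) := by
      funext y
      rw [Function.comp_apply, lefschetzPow_lefschetzPow, lefschetzPow_congr₄₅ η (show j + i = t by omega)]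
    rw [hcomp]
    exact (lefschetzPow_bijective_of_add_eq hη hnt _).1
  exact (kleimanDualPow_bijective hη hnt).1 (hLi hxx')

end Exponents

end ComplexTorus

end Literature.Geometry.Kaehler

end
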